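import Summits.BirchSwinnertonDyer.BirchSwinnertonDyer.Theses.KolyvaginRoadThree
import Summits.BirchSwinnertonDyer.BirchSwinnertonDyer.Theorems.RungK2HubKoly  -- buildfix 2026-08-26: the route file stopped importing the K2@3 hub (rev of 21:08Z); this file names `X11b.multiplicativeRankOneAtThree_of_kolyRecord` from it
import Summits.BirchSwinnertonDyer.BirchSwinnertonDyer.Theorems.KolyvaginRoadThreeKernelHL
import Summits.BirchSwinnertonDyer.BirchSwinnertonDyer.Theorems.KolyvaginRoadThreeTowerFormGross
import Summits.BirchSwinnertonDyer.BirchSwinnertonDyer.Theorems.KolyvaginRoadThreePointCertificate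
import HarnessLib

/-!
# Route `KolyvaginRoadThree`, HL child `ZhangSharpFrameAtThreeHL` (item stmt-BirchSwinnertonDyer-19574, the
# deciding crux after the (B′) split of 19153, rev 10): parent ⟹ child, the HL `closes` certified in the tree,
# and the BC5 tower-certificate reading re-keyed to the HL child
# (cell `bsd-stepL`, seat `bsd-stepL-zhang3-p1` g3; `--supports stmt-BirchSwinnertonDyer-19574`, helper)

THEOREMS ONLY (no definition, no named fact, no `sorry`); nothing about Kolyvagin's conjecture at `p = 3` is
asserted; every statement is an implication between the route's items, the landed kernels and published named
facts taken as binders. PARTITION: O2@3 (B10) × A1 (1 116 TRUE-OPEN classes; cw 248 943) — types-the-object-of;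
closes: none.

* `zhangSharpFrameAtThreeHL_of_zhangSharpFrameAtThree` — the parent frame 19153 implies the HL child a fortiori
  (the child only ADDS the binders `ClassX11b W 3`, `Odd d_K`, `L(E^{d_K},1) ≠ 0`), so every helper filed
  `--supports 19153` transfers to 19574 by name.
* `kolyvaginRoadThree_multiplicativeRankOneAtThree_of_zhangSharpFrameAtThreeHL` — the route's DECIDING THEOREM
  THROUGH THE HL CHILD, certified here as a Theorems-side theorem (the planner's `plan/D2/ClosesHL.lean` body: the hub
  `X11b.multiplicativeRankOneAtThree_of_kolyRecord` with the A1 case through the HL kernel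
  `Koly.bsdp_three_onA1_of_kolyvaginFramesHL`, p424749): `ZhangSharpFrameAtThreeHL → SchneiderTamAtThree →
  HalvesTamAtThree → HsiehDescentAtThree → EulerHalvesAtThree → ShimuraDisplaysAtThree → CornerAtThree →
  PublishedInputsKolyThree → X11b.MultiplicativeRankOneAtThree`. The route's `closes` still binds 19153 (tribunal
  record untouched); this theorem is the importable evidence that the HL child suffices, ahead of the gate's
  combined-edit verb.
* `zhangSharpFrameAtThreeHL_of_towerCertificatesHL` — the HL child from TOWER POINT CERTIFICATES on HL frames
  (zhang3-p1 g0's `KolyCert.kolyvaginClass_three_ne_zero_of_tower_not_pDiv`, p418676): the statement a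
  derived-point computation certifies (BC5 rung 347253a1 ⊗ ℚ(√−11), koly kit j249662: an HL pair).
* `towerCertificatesHL_of_zhangSharpFrameAtThreeHL_of_grossCM` — conversely the HL child gives the tower point form
  on HL frames, modulo the two published CM facts of Gross 1991 §3 (koly's `kolyvaginRoadThree_towerData_of_grossCM`,
  p423680).

References (locators only): [cite: WZhang2014, Thm. 1.1, Remark 5 and Thm. 10.2] [cite: McCallumLMS1991, §4 Cor. 4.5,
§5 Cor. 5.6] [cite: GrossLMS1991, §3 (pp. 238–239), §4 (4.1)] [cite: HoffsteinLuo1997, main theorem].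
-/

noncomputable section

open scoped Classical

-- sibling precedent (`KatoDescentPotSupersingularAssembly.lean`): the directory name repeats the summit name
set_option linter.dupNamespace false

namespace Summit.BirchSwinnertonDyer.BirchSwinnertonDyer.Theorems

open WeierstrassCurve NumberField Literature.NumberTheory.EllipticCurves
  Literature.NumberTheory.EllipticCurves.ModularForms
  Summit.BirchSwinnertonDyer.BirchSwinnertonDyer.Theses.KolyvaginRoadThree
  Summit.BirchSwinnertonDyer.Rank1Residual.X11b.Three.Koly

/-! ## §1 Parent ⟹ HL child -/

/-- **The parent frame 19153 implies the HL child 19574** (the child's extra binders `ClassX11b W 3`,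
`Odd (NumberField.discr K)`, `(W.quadraticTwist d_K).entireLFunction 1 ≠ 0` are simply not used): every helper
landed `--supports stmt-BirchSwinnertonDyer-19153` serves 19574 a fortiori. Pure logic. [folklore] -/
theorem zhangSharpFrameAtThreeHL_of_zhangSharpFrameAtThree (h : ZhangSharpFrameAtThree) :
    ZhangSharpFrameAtThreeHL :=
  fun W _ _ _ K _ _ Dt β ι _hX hmult hsurj hram htam hK _hodd hH _hLt h3 hβ hc ↦
    h W K Dt β ι hmult hsurj hram htam hK hH h3 hβ hc

/-! ## §2 The deciding theorem through the HL child (the D2 `closes`, certified in the tree) -/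

/-- **Rung K2@3's leaf from the HL child and the route's other items** — the planner's `plan/D2/ClosesHL.lean`
VERBATIM as a Theorems-side theorem: `h₈ : PublishedInputsKolyThree` is destructured into ClassRecordThree's twenty
facts ∧ McCallum ∧ Shimura reciprocity at conductor 1 ∧ the conductor-1 data (seam G-a); the A1 case of the hub
`X11b.multiplicativeRankOneAtThree_of_kolyRecord` (koly p410949) is the HL kernel
`Koly.bsdp_three_onA1_of_kolyvaginFramesHL` (p424749) applied to `h₁`; the other binders are projections of
`h₂ … h₇`. CONDITIONAL on every binder (seven open items + the support conjunction); nothing is booked.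
[cite: WZhang2014, Thm. 1.1 and Remark 5] [cite: McCallumLMS1991, §5 Cor. 5.6 (p. 310)] -/
theorem kolyvaginRoadThree_multiplicativeRankOneAtThree_of_zhangSharpFrameAtThreeHL
    (h₁ : ZhangSharpFrameAtThreeHL) (h₂ : SchneiderTamAtThree) (h₃ : HalvesTamAtThree)
    (h₄ : HsiehDescentAtThree) (h₅ : EulerHalvesAtThree) (h₆ : ShimuraDisplaysAtThree) (h₇ : CornerAtThree)
    (h₈ : PublishedInputsKolyThree) :
    Summit.BirchSwinnertonDyer.Rank1Residual.X11b.MultiplicativeRankOneAtThree := by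
  obtain ⟨⟨hGZ, hKo, hB, hSk, hWu, hGZK, hmod, hnf, hHL, hMaz, hPT, hFH, hBR, hSkA, hJn, hHn, hD, hpar, hMN, hH⟩,
    hMc, hrec, hKD⟩ := h₈
  exact Summit.BirchSwinnertonDyer.Rank1Residual.X11b.multiplicativeRankOneAtThree_of_kolyRecord
    hGZ hKo hB hSk hWu hGZK hmod hnf hHL hMaz hPT hFH hBR hSkA hJn hHn hD hpar hMN hH
    (fun W _ _ hX hram htam ↦
      Summit.BirchSwinnertonDyer.Rank1Residual.X11b.Three.Koly.bsdp_three_onA1_of_kolyvaginFramesHL hGZ hKo hB hSk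
        hGZK hmod hnf hHL hMaz hrec hMc hKD h₁ W hX hram htam)
    h₂ (fun W _ _ hX ↦ (h₄ W hX).1) (fun W _ _ hX ↦ (h₃ W hX).1) h₆
    (fun W _ _ hX ↦ (h₅ W hX).1) (fun W _ _ hX ↦ (h₅ W hX).2.1)
    (fun W _ _ hX ↦ (h₄ W hX).2) (fun W _ _ hX ↦ (h₃ W hX).2) (fun W _ _ hX ↦ (h₅ W hX).2.2)
    (fun W _ _ ↦ (h₇ W).1) (fun W _ _ ↦ (h₇ W).2.1) (fun W _ _ ↦ (h₇ W).2.2)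

/-- **The same with the parent 19153 in place of the child** (sanity: the current `closes` binder also goes
through the HL kernel, via §1). [folklore] -/
theorem kolyvaginRoadThree_multiplicativeRankOneAtThree_of_zhangSharpFrameAtThree_viaHL
    (h₁ : ZhangSharpFrameAtThree) (h₂ : SchneiderTamAtThree) (h₃ : HalvesTamAtThree)
    (h₄ : HsiehDescentAtThree) (h₅ : EulerHalvesAtThree) (h₆ : ShimuraDisplaysAtThree) (h₇ : CornerAtThree)
    (h₈ : PublishedInputsKolyThree) :
    Summit.BirchSwinnertonDyer.Rank1Residual.X11b.MultiplicativeRankOneAtThree :=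
  kolyvaginRoadThree_multiplicativeRankOneAtThree_of_zhangSharpFrameAtThreeHL
    (zhangSharpFrameAtThreeHL_of_zhangSharpFrameAtThree h₁) h₂ h₃ h₄ h₅ h₆ h₇ h₈

/-! ## §3 The HL child and tower point certificates (BC5 reading for 19574) -/

/-- **The HL child from tower point certificates on HL frames.**  `ZhangSharpFrameAtThreeHL` FOLLOWS from the pure
point-divisibility statement on its own binders: at every HL frame there are a square-free product `n` of
Zhang–Kolyvagin primes for `p = 3` and Kolyvagin–Heegner data `d m` at every level `m ∣ n` whose TOP derived point is
not divisible by `3` in `E(K[n])`.  The invariance clause and admissibility are supplied by zhang3-p1 g0's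
`KolyCert.kolyvaginClass_three_ne_zero_of_tower_not_pDiv` (McCallum Cor. 4.5, Gross Prop. 3.6 at Zhang–Kolyvagin
primes, `Surj W 3`).  This is the statement a derived-point computation certifies at one pair (BC5 rung:
347253a1 ⊗ ℚ(√−11), `ℓ = 2`, koly kit j249662 — an HL pair: `d_K = −11` odd, `L(E^{(−11)},1) ≠ 0`).
[cite: McCallumLMS1991, §4 (4), Cor. 4.5] [cite: GrossLMS1991, §3, Prop. 3.6, §4 (4.1), Prop. 4.7 (1)] -/
theorem zhangSharpFrameAtThreeHL_of_towerCertificatesHL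
    (h : ∀ (W : WeierstrassCurve ℚ) [W.IsElliptic] [W.IsGloballyMinimal] [NeZero (W.conductorNorm ℤ)]
      (K : Type) [Field K] [NumberField K]
      (Dt : ModularParametrizationData W (W.conductorNorm ℤ)) (β : ℤ) (ι : K →+* ℂ),
      Summit.BirchSwinnertonDyer.Rank1Residual.ClassX11b W 3 →
      W.HasMultiplicativeReductionAtPrime 3 → Rank1Residual.Surj W 3 → Rank1Residual.Ram W 3 →
      ¬ 3 ∣ W.tamagawaProduct → IsImaginaryQuadratic K → Odd (NumberField.discr K) →
      SatisfiesHeegnerHypothesis (W.conductorNorm ℤ) K →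
      (W.quadraticTwist (NumberField.discr K : ℚ)).entireLFunction 1 ≠ 0 → NumberField.discr K ≠ -3 →
      (4 * (W.conductorNorm ℤ : ℤ)) ∣ β ^ 2 - NumberField.discr K → ¬ (3 : ℤ) ∣ Dt.c →
      ∃ (n : ℕ) (d : (m : ℕ) → m ∣ n → KolyvaginHeegnerData Dt β ι m),
        KolyvaginDescent.KolSupp (Zhang2014.IsKolyvaginPrime (W.conductorNorm ℤ) W K 3) n ∧
          ¬ PDiv (d n dvd_rfl) 3 1) :
    ZhangSharpFrameAtThreeHL := by
  intro W _ _ _ K _ _ Dt β ι hX hmult hsurj hram htam hK hodd hH hLt h3 hβ hc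
  obtain ⟨n, d, hn, hcert⟩ := h W K Dt β ι hX hmult hsurj hram htam hK hodd hH hLt h3 hβ hc
  exact ⟨n, d n dvd_rfl, hn,
    Summit.BirchSwinnertonDyer.Rank1Residual.X11b.Three.KolyCert.kolyvaginClass_three_ne_zero_of_tower_not_pDiv
      W K Dt β ι hmult hsurj hK hH hn d hcert⟩

/-- **HL child ⟹ tower point form on HL frames, modulo the two published CM facts of Gross 1991 §3** (`y(m) ∈ E(K[m])`
and `G_ℓ` cyclic, named facts `h1`, `h2` — hypotheses; koly's `kolyvaginRoadThree_towerData_of_grossCM`, p423680,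
supplies the Kolyvagin–Heegner data at the lower levels; the top datum is the crux's own, where `3 ∤ P(n)` is
`Koly.not_pDiv_of_kolyvaginClass_ne_zero`).  With `zhangSharpFrameAtThreeHL_of_towerCertificatesHL` the HL child is
EQUIVALENT to its tower point form modulo these two facts. CONDITIONAL on `h1`, `h2` and `hZ`; nothing asserted.
[cite: GrossLMS1991, §3 (pp. 238–239) and §4 (4.1)] [cite: McCallumLMS1991, Cor. 4.5] -/
theorem towerCertificatesHL_of_zhangSharpFrameAtThreeHL_of_grossCM
    (h1 : ∀ (N : ℕ) [NeZero N] (W : WeierstrassCurve ℚ) (K : Type) [Field K] [NumberField K],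
      phi_heegnerPointOfConductor_mem_range_map_ringClassField N W K)
    (h2 : ∀ (K : Type) [Field K] [NumberField K], exists_generator_ringClassGalOver K)
    (hZ : ZhangSharpFrameAtThreeHL) :
    ∀ (W : WeierstrassCurve ℚ) [W.IsElliptic] [W.IsGloballyMinimal] [NeZero (W.conductorNorm ℤ)]
      (K : Type) [Field K] [NumberField K]
      (Dt : ModularParametrizationData W (W.conductorNorm ℤ)) (β : ℤ) (ι : K →+* ℂ),
      Summit.BirchSwinnertonDyer.Rank1Residual.ClassX11b W 3 →
      W.HasMultiplicativeReductionAtPrime 3 → Rank1Residual.Surj W 3 → Rank1Residual.Ram W 3 →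
      ¬ 3 ∣ W.tamagawaProduct → IsImaginaryQuadratic K → Odd (NumberField.discr K) →
      SatisfiesHeegnerHypothesis (W.conductorNorm ℤ) K →
      (W.quadraticTwist (NumberField.discr K : ℚ)).entireLFunction 1 ≠ 0 → NumberField.discr K ≠ -3 →
      (4 * (W.conductorNorm ℤ : ℤ)) ∣ β ^ 2 - NumberField.discr K → ¬ (3 : ℤ) ∣ Dt.c →
      ∃ (n : ℕ) (d : (m : ℕ) → m ∣ n → KolyvaginHeegnerData Dt β ι m),
        KolyvaginDescent.KolSupp (Zhang2014.IsKolyvaginPrime (W.conductorNorm ℤ) W K 3) n ∧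
          ¬ PDiv (d n dvd_rfl) 3 1 := by
  intro W _ _ _ K _ _ Dt β ι hX hmult hsurj hram htam hK hodd hH hLt h3 hβ hc
  obtain ⟨n, dn, hn, hne⟩ := hZ W K Dt β ι hX hmult hsurj hram htam hK hodd hH hLt h3 hβ hc
  have hKD := kolyvaginRoadThree_towerData_of_grossCM h1 h2
  -- the CM facts supply data at every square-free inert level; the crux's datum sits on top
  have hinert : ∀ m : ℕ, m ∣ n → ∀ q ∈ m.primeFactors, (Ideal.span {(q : 𝓞 K)}).IsPrime :=
    fun m hm q hq ↦ (hn.2 q (Nat.primeFactors_mono hm hn.1.ne_zero hq)).2.2.2.2.1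
  let d : (m : ℕ) → m ∣ n → KolyvaginHeegnerData Dt β ι m := fun m hm ↦
    if h : m = n then h ▸ dn
    else Classical.choice (hKD W K Dt β ι m hK hH hβ (hn.1.squarefree_of_dvd hm) (hinert m hm))
  have hdn : d n dvd_rfl = dn := by
    show (if h : n = n then h ▸ dn else _) = dn
    rw [dif_pos rfl]
  refine ⟨n, d, hn, ?_⟩
  rw [hdn]
  exact not_pDiv_of_kolyvaginClass_ne_zero dn hne

end Summit.BirchSwinnertonDyer.BirchSwinnertonDyer.Theorems

end
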